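import Summits.Ventures.HodgeRepro2.Hypothesis

/-!
# HodgeRepro2 — the archimedean component of the automorphic datum (statement shapes)

Blind re-derivation cell `pub-hodge-repro2`, seat p2 (file 7; imports `Hypothesis.lean`).

The automorphic datum of the transfer is a Hecke character `λ` of the CM-field `K` (= `M` of
[DR15], `E` of [Liu21]) of "weight one" with respect to a CM-type `Φ`:
* [DR15] Dimitrov–Ramakrishnan, Doc. Math. 20 (2015), Definition 3.1 (QUOTE): "`λ` is a unitary
  Hecke character of `M` whose restriction to `F` is `ω`, […] such that
  `λ_∞(z) = ∏_{v∈Φ} z̄_v/|z_v|`, for all `z ∈ M_∞`, […] for some CM type `Φ` on `M`";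
* [Liu21] Y. Liu, Cambridge J. Math. 9 (2021), p. 41 (QUOTE): "For a conjugate symplectic […]
  automorphic character `μ`, there exist a CM type `Φ_μ` and a unique tuple `w_μ = (w_τ)_{τ∈Φ_F}`
  of odd […] nonnegative integers such that for every `τ ∈ Φ_F`, the component
  `μ_τ : (E ⊗_{F,τ} ℝ)^× → ℂ^×` is the character `z ↦ arg(z)^{−w_τ}`, where we have identified
  `(E ⊗_{F,τ} ℝ)^×` with `ℂ^×` via the unique element `τ' ∈ Φ_μ` above `τ`", Definition 4.3:
  weight one = `w_τ = 1` for all `τ`.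

Only the archimedean component is formalised: `K ⊗ ℝ ≅ ∏_{w} ℂ` through Mathlib's chosen
embeddings `w.embedding`; the CM-type `Φ` decides, at each infinite place `w`, whether the
identification with `ℂ` is `w.embedding` (then `z ↦ z̄/|z|`) or its conjugate (then `z ↦ z/|z|`).
This is the `ι₁ / ῑ₁` bookkeeping of the identification subtlety made explicit: replacing `Φ` by
its conjugate at `w` replaces the factor by its complex conjugate.  Nothing adelic (the finite
part, the restriction to `F`, unitarity as a global character) is formalised.
-/

namespace Summit.Ventures.HodgeRepro2.ShimuraData

open NumberField

noncomputable section

variable (K : Type*) [Field K] [NumberField K] [IsCMField K]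

open scoped Classical in
/-- The archimedean component `z ↦ z̄/|z|` at the infinite place `w` read through the embedding
chosen by `Φ`: `conj z / ‖z‖` if `Φ w = w.embedding`, and `z / ‖z‖` otherwise (the conjugate
identification).  `z` is the coordinate of `K ⊗ ℝ` at `w` via `w.embedding`. -/
def weightOneFactor (Φ : CMTypeChoice K) (w : InfinitePlace K) (z : ℂ) : ℂ :=
  if Φ.emb w = w.embedding then (starRingEnd ℂ) z / ‖z‖ else z / ‖z‖

/-- The archimedean component of a weight-one character for the CM-type `Φ`:
`λ_∞(z) = ∏_{w} (z̄_w/|z_w|)` with the `Φ`-identification at each place ([DR15] (weight1),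
[Liu21] `arg(z)^{-1}` for `w_τ = 1`). -/
def weightOneInfinityType (Φ : CMTypeChoice K) (z : InfinitePlace K → ℂ) : ℂ :=
  ∏ w, weightOneFactor K Φ w (z w)

/-- An archimedean character `lamInf : (K ⊗ ℝ)^× ≅ ∏_w ℂ^× → ℂ^×` has weight one for `Φ` if it equals
`weightOneInfinityType K Φ` on all units. -/
def HasWeightOneInfinityType (Φ : CMTypeChoice K) (lamInf : (InfinitePlace K → ℂ) → ℂ) : Prop :=
  ∀ z : InfinitePlace K → ℂ, (∀ w, z w ≠ 0) → lamInf z = weightOneInfinityType K Φ z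

omit [NumberField K] [IsCMField K] in
/-- The weight-one factor for the conjugate choice at `w` is the complex conjugate of the factor
for `Φ` (the `ι₁ / ῑ₁` switch): if `Φ` and `Φ'` differ at `w`, then
`weightOneFactor Φ' w z = conj (weightOneFactor Φ w z)`. -/
theorem weightOneFactor_conj (Φ Φ' : CMTypeChoice K) (w : InfinitePlace K)
    (h : Φ.emb w ≠ Φ'.emb w) (z : ℂ) :
    weightOneFactor K Φ' w z = (starRingEnd ℂ) (weightOneFactor K Φ w z) := by
  classical
  -- exactly one of `Φ.emb w`, `Φ'.emb w` is `w.embedding` (both lie above `w`)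
  have hΦ := InfinitePlace.embedding_mk_eq (Φ.emb w)
  have hΦ' := InfinitePlace.embedding_mk_eq (Φ'.emb w)
  rw [Φ.emb_mk] at hΦ
  rw [Φ'.emb_mk] at hΦ'
  rcases hΦ with h1 | h1 <;> rcases hΦ' with h2 | h2
  · exact absurd (h1.symm.trans h2) h
  · have hΦ : Φ.emb w = w.embedding := h1.symm
    have hΦ' : Φ'.emb w ≠ w.embedding := fun h3 => h (hΦ.trans h3.symm)
    simp [weightOneFactor, hΦ, hΦ', map_div₀, Complex.conj_ofReal]
  · have hΦ : Φ.emb w ≠ w.embedding := fun h3 => h (h3.trans h2)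
    have hΦ' : Φ'.emb w = w.embedding := h2.symm
    simp [weightOneFactor, hΦ, hΦ', map_div₀, Complex.conj_ofReal]
  · exact absurd ((ComplexEmbedding.involutive_conjugate K).injective (h1.symm.trans h2)) h

end

end Summit.Ventures.HodgeRepro2.ShimuraData
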